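import Summits.AtomisticToContinuum.HydrodynamicLimit.Theses.ImplosionDichotomy
import Summits.AtomisticToContinuum.HydrodynamicLimit.Theorems.CollisionIsometryCLTMacroClosureInBand
import HarnessLib

/-!
# The crux `MacroClosure` AS TYPED delivers the PER-PROFILE in-band engine; its as-designed dock through
`DiluteSelfConsistency` (stmt-3091) — line `IdeatorTwoGen1Sketch`, crux stmt-AtomisticToContinuum-14870

Support file (`--supports stmt-AtomisticToContinuum-14870`) of the line lead (continuation c3). The crux as typed,
`MacroClosure := CollisionalTransferLocality → AprioriBoundsPreShock → FastMomentRelaxationPreShock → HydrodynamicLimit`,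
fixes its dilute level `η₁` AFTER the profiles (`∀ profiles, ∃ σ₀, ∃ η₁`) while the re-typed conjunct (D-0032) fixes
`η₀` BEFORE them. What the per-profile hypotheses DO give, unconditionally, is the PER-PROFILE in-band engine
`EngineLocal` (`∀ profiles ∃ σ₀ ∃ η`, landed statement in `…MacroClosureDefs.lean`): `engineLocal_proof` below — the
two-scale barycentric engine (`stub_engine_twoScale`), two-scale Clausius in mean (`stub_clausius_twoScale`) from the
two-scale block MGF (`stub_blockMGF_twoScale`), thermodynamics (`stub_thermo`), Ruelle convexity
(`stub_hsFreeEnergyConvex`) and the initial entropy value (`stub_initialEntropy`), all landed, fed with the crux's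
OWN hypotheses at level `η := min η₃ (min η₁ᴬ η₁ᶠ) / 2` per profile. The crux as DESIGNED (its informal
decomposition lists `DiluteSelfConsistency` 3091) then follows: `macroClosure_of_dsc` — 3091 (`∀ η > 0` outermost)
turns the per-profile level into the conjunct's guard (`η₀ := 1`). Together with the landed uniform dock
(`macroClosure_of_uniformInputs`: the crux modulo stmt-17749 and the in-band hinge) this exhausts the pure-logic
closures of the crux as typed: per-profile inputs + 3091, or uniform inputs.
-/

noncomputable section

open MeasureTheory Filter Set Topology InformationTheory
open scoped ENNReal ContDiff

namespace Summit.AtomisticToContinuum.HydrodynamicLimit.Theorems.MacroClosureLine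

open Literature.MathematicalPhysics.KineticTheory Literature.Analysis.FluidPDE
open Literature.Analysis.FunctionSpaces
open Summit.AtomisticToContinuum.HydrodynamicLimit.Theses
open Summit.AtomisticToContinuum.HydrodynamicLimit.Theses.CollisionIsometryCLT

namespace Barycentric

/-- **Profile-wise two-scale threshold bookkeeping**: the two-scale pointwise engine (`stub_engine_twoScale`), fed
with the PER-PROFILE kinetic hypotheses of the crux as typed, collisional transfer locality and two-scale Clausius in
mean for one pair of admissible kernel families, gives the profile-wise in-band engine `EngineLocal` with
`σ₀ := min (1/2) (min σ_C (min σ_A (min σ_F σ_Cl)))` and `η := min η₃ (min η₁ᴬ η₁ᶠ) / 2` chosen per profile; the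
engine's guard supplies the chamber and both dilute provisos. [folklore] -/
theorem engineLocal_of_twoScale (η₃ : ℝ) (hη₃ : 0 < η₃) (hT : ThermoChamber η₃)
    (hH : StiffCollisionalRelaxation.HsFreeEnergyConvex)
    (γ C : ℝ) (φ : ℕ → T3 → ℝ) (hγ : 0 < γ) (hγ' : γ ≤ 1 / 15) (hφ : AdmissibleKernel γ C φ)
    (γ₂ C₂ : ℝ) (φ₂ : ℕ → T3 → ℝ) (hγ₂ : 0 < γ₂) (hγ₂' : γ₂ ≤ 1 / 15) (hφ₂ : AdmissibleKernel γ₂ C₂ φ₂)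
    (hCl : ∀ (a₀ θ₀ : T3 → ℝ) (u₀ : T3 → V3), Continuous a₀ → Continuous θ₀ → Continuous u₀ →
      (∀ x, 0 < a₀ x) → (∀ x, 0 < θ₀ x) →
      ∃ σ₀ : ℝ, 0 < σ₀ ∧ ∀ σ : ℝ, 0 < σ → σ < σ₀ →
      ∀ (T : ℝ) (ρ θ : ℝ → T3 → ℝ) (u : ℝ → T3 → V3), IsHardSphereEulerSolution σ T ρ u θ →
        ∀ Φ : (N : ℕ) → Flow σ N,
          TendstoHydroFieldsAt (fun N => localGibbsLaw σ a₀ u₀ θ₀ N (Φ N)) Φ ρ u θ 0 →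
          0 < γ → γ ≤ 1 / 15 → AdmissibleKernel γ C φ → 0 < γ₂ → γ₂ ≤ 1 / 15 → AdmissibleKernel γ₂ C₂ φ₂ →
          ∀ (c₁ c₂ t₁ : ℝ), 0 < c₁ → 0 < c₂ → 0 < t₁ → t₁ < T →
          ∀ G : (N : ℕ) → Set (Config (N + 1) (Fin 3) T3), (∀ N, MeasurableSet (G N)) →
            (∀ N, G N ⊆ (Φ N).good) →
            (∀ N, ∀ z ∈ G N, ∀ s ∈ Icc 0 t₁, ∀ x,
                c₁ ≤ bρ (φ N) ((Φ N).flow s z) x ∧ bρ (φ N) ((Φ N).flow s z) x * σ ^ 3 ≤ 1) →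
            (∀ N, ∀ z ∈ G N, ∀ s ∈ Icc 0 t₁, ∀ x,
                c₂ ≤ bρ (φ₂ N) ((Φ N).flow s z) x ∧ bρ (φ₂ N) ((Φ N).flow s z) x * σ ^ 3 ≤ 1) →
            Tendsto (fun N => localGibbsLaw σ a₀ u₀ θ₀ N (Φ N) (G N)ᶜ) atTop (𝓝 0) →
            ∀ δ : ℝ, 0 < δ → ∀ᶠ N : ℕ in atTop, ∀ s ∈ Icc 0 t₁,
              Integrable (fun z => (G N).indicator
                  (fun z => ∫ x, hsEntropy σ (bU (φ N) ((Φ N).flow s z) x)) z)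
                (localGibbsLaw σ a₀ u₀ θ₀ N (Φ N)) ∧
              ∫ z, (G N).indicator (fun z => ∫ x, hsEntropy σ (bU (φ N) ((Φ N).flow s z) x)) z
                  ∂(localGibbsLaw σ a₀ u₀ θ₀ N (Φ N)) ≤
                (∫ x, hsEntropy σ (stateOf (ρ 0 x) (u 0 x) (θ 0 x))) + δ)
    (hC : CollisionalTransferLocality) (hA : AprioriBoundsPreShock) (hF : FastMomentRelaxationPreShock) :
    EngineLocal := by
  intro a₀ θ₀ u₀ ha hθ hu ha0 hθ0
  obtain ⟨σC, hσC, HC⟩ := hC a₀ θ₀ u₀ ha hθ hu ha0 hθ0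
  obtain ⟨σA, hσA, ηA, hηA, HA⟩ := hA a₀ θ₀ u₀ ha hθ hu ha0 hθ0
  obtain ⟨σF, hσF, ηF, hηF, HF⟩ := hF a₀ θ₀ u₀ ha hθ hu ha0 hθ0
  obtain ⟨σL, hσL, HL⟩ := hCl a₀ θ₀ u₀ ha hθ hu ha0 hθ0
  refine ⟨min (1 / 2) (min σC (min σA (min σF σL))),
    lt_min one_half_pos (lt_min hσC (lt_min hσA (lt_min hσF hσL))),
    min η₃ (min ηA ηF) / 2, by positivity, ?_⟩
  intro σ hσ hσlt T ρ θ u hsol Φ h0 hguard t ht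
  have hσ2 : σ < 2⁻¹ := by
    have := lt_of_lt_of_le hσlt (min_le_left _ _); norm_num at this ⊢; linarith
  have hσC' : σ < σC := lt_of_lt_of_le hσlt ((min_le_right _ _).trans (min_le_left _ _))
  have hσA' : σ < σA :=
    lt_of_lt_of_le hσlt ((min_le_right _ _).trans ((min_le_right _ _).trans (min_le_left _ _)))
  have hσF' : σ < σF := lt_of_lt_of_le hσlt
    ((min_le_right _ _).trans ((min_le_right _ _).trans ((min_le_right _ _).trans (min_le_left _ _))))
  have hσL' : σ < σL := lt_of_lt_of_le hσlt
    ((min_le_right _ _).trans ((min_le_right _ _).trans ((min_le_right _ _).trans (min_le_right _ _))))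
  rcases (eq_or_lt_of_le ht.1) with h | htpos
  · subst h; exact h0
  have htT : t < T := ht.2
  have hσ3 : 0 < σ ^ 3 := pow_pos hσ 3
  have hch : ∀ s ∈ Ico 0 T, ∀ x, ρ s x * σ ^ 3 < η₃ := fun s hs x =>
    (hguard s hs x).trans_le ((half_le_self (by positivity)).trans (min_le_left _ _))
  have hprovA : ∀ s ∈ Icc 0 t, ∀ x, 2 * ρ s x * σ ^ 3 < ηA := by
    intro s hs x
    have h1 := hguard s ⟨hs.1, hs.2.trans_lt htT⟩ x
    have h2 : min η₃ (min ηA ηF) / 2 ≤ ηA / 2 := by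
      gcongr; exact (min_le_right _ _).trans (min_le_left _ _)
    linarith
  have hprovF : ∀ s ∈ Icc 0 t, ∀ x, 2 * ρ s x * σ ^ 3 < ηF := by
    intro s hs x
    have h1 := hguard s ⟨hs.1, hs.2.trans_lt htT⟩ x
    have h2 : min η₃ (min ηA ηF) / 2 ≤ ηF / 2 := by
      gcongr; exact (min_le_right _ _).trans (min_le_right _ _)
    linarith
  have hA' := HA σ hσ hσA' T ρ θ u hsol Φ h0 t htpos htT hprovA
  have hF' := HF σ hσ hσF' T ρ θ u hsol Φ h0 γ C φ hγ hγ' hφ t htpos htT hprovF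
  have hθinv : Torus.IsSmoothSpaceTimeOn (Ico 0 T) (fun s x => (θ s x)⁻¹) :=
    ContDiffOn.inv hsol.smooth_temperature fun p hp =>
      (hsol.temperature_pos p.1 (mem_prod.1 hp).1 (Torus.proj p.2)).ne'
  have hlamM : Torus.IsSmoothSpaceTimeOn (Icc 0 t) (lamM θ u) :=
    (hθinv.smul hsol.smooth_velocity).mono (Icc_subset_Ico_right htT)
  have hlamE : Torus.IsSmoothSpaceTimeOn (Icc 0 t) (lamE θ) :=
    hθinv.neg.mono (Icc_subset_Ico_right htT)
  have hC' := HC σ hσ hσC' Φ γ C φ hγ hγ' hφ t htpos (lamM θ u) (lamE θ) hlamM hlamE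
  have hCl' := HL σ hσ hσL' T ρ θ u hsol Φ h0 hγ hγ' hφ hγ₂ hγ₂' hφ₂
  refine stub_engine_twoScale σ hσ hσ2 hH a₀ θ₀ u₀ ha hθ hu ha0 hθ0 T ρ θ u hsol η₃ hT hch Φ h0 γ C φ hγ
    hγ' hφ φ₂ t htpos htT hA'.1 (hA'.2 γ C φ hγ hγ' hφ) (hA'.2 γ₂ C₂ φ₂ hγ₂ hγ₂' hφ₂) hF' hC' ?_
  intro c₁ hc₁ c₂ hc₂ G hGm hGg hGb hGb₂ hGc
  exact hCl' c₁ c₂ t hc₁ hc₂ htpos htT G hGm hGg hGb hGb₂ hGc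

/-- **The hypotheses of the crux as typed give the PER-PROFILE in-band engine, unconditionally**: collisional
transfer locality, the pre-shock a-priori bounds (stmt-14827) and the pre-shock hinge (stmt-14902) — each with its
dilute level after the profiles — yield `EngineLocal` (LLN propagation to every `t < T` for classical solutions in a
PROFILE-DEPENDENT chamber `ρσ³ < η`), via thermodynamics, the two-scale block MGF, two-scale Clausius in mean and
the two-scale barycentric engine, all landed. This is the full mathematical content of the crux as typed short of
the order of `η` and the profiles. [cite: Dafermos2005, Thm 5.2.1] [cite: Ruelle1969, §3.4] -/
theorem engineLocal_proof (hC : CollisionalTransferLocality) (hA : AprioriBoundsPreShock)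
    (hF : FastMomentRelaxationPreShock) : EngineLocal := by
  obtain ⟨η₃, hη₃, hT⟩ := stub_thermo
  obtain ⟨γ, C, φ, γ₂, C₂, φ₂, hγ, hγ', hφ, hγ₂, hγ₂', hφ₂, hM⟩ := stub_blockMGF_twoScale
  have hCl := stub_clausius_twoScale stub_hsFreeEnergyConvex γ C φ γ₂ C₂ φ₂ hM stub_initialEntropy
  exact engineLocal_of_twoScale η₃ hη₃ hT stub_hsFreeEnergyConvex γ C φ hγ hγ' hφ γ₂ C₂ φ₂
    hγ₂ hγ₂' hφ₂ hCl hC hA hF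

/-- **Dock of the per-profile engine through dilute self-consistency** (stmt-3091, `∀ η > 0` outermost): the
per-profile level `η` of `EngineLocal` is fed to `DiluteSelfConsistency`, whose conclusion is the engine's guard;
the conjunct's own guard is then idle (`η₀ := 1`). [folklore] -/
theorem hydrodynamicLimit_of_engineLocal_of_dsc (hE : EngineLocal)
    (hD : ImplosionDichotomy.DiluteSelfConsistency) : _root_.HydrodynamicLimit := by
  refine ⟨1, one_pos, ?_⟩
  intro a₀ θ₀ u₀ ha hθ hu ha0 hθ0
  obtain ⟨σ₁, hσ₁, η, hη, HE⟩ := hE a₀ θ₀ u₀ ha hθ hu ha0 hθ0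
  obtain ⟨σ₂, hσ₂, HD⟩ := hD η hη a₀ θ₀ u₀ ha hθ hu ha0 hθ0
  refine ⟨min σ₁ σ₂, lt_min hσ₁ hσ₂, ?_⟩
  intro σ hσ hσlt T ρ θ u hsol _hguard Φ h0 t ht
  exact HE σ hσ (lt_of_lt_of_le hσlt (min_le_left _ _)) T ρ θ u hsol Φ h0
    (fun s hs x => HD σ hσ (lt_of_lt_of_le hσlt (min_le_right _ _)) T ρ θ u hsol Φ h0 s hs x) t ht

/-- **The crux as typed, modulo dilute self-consistency ALONE** (its as-filed decomposition: engine + statics +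
stmt-3091, "then pure logic"): `DiluteSelfConsistency → MacroClosure`. With `macroClosure_of_uniformInputs`
(uniform inputs, no 3091) these are the two pure-logic closures of the crux as typed. [folklore] -/
theorem macroClosure_of_dsc (hD : ImplosionDichotomy.DiluteSelfConsistency) : MacroClosure :=
  fun hC hA hF => hydrodynamicLimit_of_engineLocal_of_dsc (engineLocal_proof hC hA hF) hD

end Barycentric

end Summit.AtomisticToContinuum.HydrodynamicLimit.Theorems.MacroClosureLine

end
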